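import Summits.FinalStateConjecture.FinalStateConjecture.Theorems.SwallowTheDatumUniversalWitnessFamilyRegionOneAnalysis
import Mathlib.Analysis.Calculus.InverseFunctionTheorem.FDeriv
import Mathlib.Analysis.InnerProductSpace.Calculus
import Mathlib.Analysis.SpecialFunctions.Sqrt

/-!
# Crux `SwallowTheDatum.UniversalWitnessFamily` (stmt-FinalStateConjecture-10051), line `Sketch`,
# stub `stub_regionOneDecomposition` — part 6: the coordinate maps as local diffeomorphisms

Generic calculus of TIME-SHIFT maps `Φ(x) = x + g(x) e₀` of `E4` (both charts of the decomposition are of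
this form: the hole map with `g = bend(x⁰, ‖x̃‖)` after the time squash, the flat map with
`g = 2 torH(‖x̃‖)`):

* `timeShiftEquiv` — the differential `v ↦ v + g'(v) e₀` is invertible as soon as `1 + g'(e₀) ≠ 0`
  (explicit inverse `w ↦ w − g'(w)/(1 + g'(e₀)) e₀`), so `Φ` maps neighbourhoods onto neighbourhoods
  (`map_nhds_timeShift`, inverse function theorem in the form `HasStrictFDerivAt.map_nhds_eq_of_equiv`);
* `isOpenEmbedding_restrict_of_coords` — a map between open subsets of `E4` given in coordinates by such a
  `Φ`, injective and neighbourhood-surjective on an open set `W`, restricts to an open embedding of `W`;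
* smoothness of the concrete maps off the time axis / beyond `r = 2M` (`contDiffAt_spatialNorm`,
  `contDiff_squashMap`, `contDiffAt_bend₂`, `contDiffAt_bentMap`, `contDiffAt_holeMap`, `contDiffAt_outMap`),
  the basic identities (`squashMap` lands in `{x⁰ > τ₀}`, is the identity on `{x⁰ ≥ τ₀ + 1}`, all maps
  preserve the spatial part), the value `d(bend ∘ (x⁰, ‖x̃‖))(e₀) = ∂_t bend` (`fderiv_bendAt_basisVector`),
  and the fibre surjectivity of `t ↦ t + bend M t r` beyond the late time (`exists_add_bend_eq`, IVT).

References: O'Neill 1983, Ch. 1 (inverse function theorem); folklore calculus.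
-/

set_option linter.dupNamespace false

noncomputable section

open scoped Topology Manifold ContDiff
open Set Function Filter Literature.Geometry.Lorentzian

namespace Summit.FinalStateConjecture.FinalStateConjecture.Theorems.SwallowTheDatum.UniversalWitnessFamily

/-! ## Time-shift differentials are invertible -/

section TimeShift

/-- `e₀⁰ = 1`. -/
theorem basisVector_zero_apply_zero : (E4.basisVector 0 : E4) 0 = 1 := by simp

/-- The spatial part of `e₀` vanishes. -/
theorem spatial_basisVector_zero : E4.spatial (E4.basisVector 0) = 0 := by
  ext i; rw [E4.spatial_apply]; simp

/-- Adding a multiple of `e₀` does not change the spatial part. -/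
theorem spatial_add_smul_basisVector (x : E4) (c : ℝ) : E4.spatial (x + c • E4.basisVector 0) = E4.spatial x := by
  rw [map_add, map_smul, spatial_basisVector_zero, smul_zero, add_zero]

/-- Adding a multiple of `e₀` does not change the spatial radius. -/
theorem spatialNorm_add_smul_basisVector (x : E4) (c : ℝ) :
    E4.spatialNorm (x + c • E4.basisVector 0) = E4.spatialNorm x := by
  unfold E4.spatialNorm; rw [spatial_add_smul_basisVector]

/-- **The time-shift differential is invertible.** For a continuous linear functional `φ` on `E4` with
`1 + φ(e₀) ≠ 0`, the map `v ↦ v + φ(v) e₀` is a continuous linear equivalence with inverse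
`w ↦ w − φ(w)/(1 + φ(e₀)) e₀`. -/
def timeShiftEquiv (φ : E4 →L[ℝ] ℝ) (h : 1 + φ (E4.basisVector 0) ≠ 0) : E4 ≃L[ℝ] E4 :=
  ContinuousLinearEquiv.equivOfInverse
    (ContinuousLinearMap.id ℝ E4 + φ.smulRight (E4.basisVector 0))
    (ContinuousLinearMap.id ℝ E4 - ((1 + φ (E4.basisVector 0))⁻¹ • φ).smulRight (E4.basisVector 0))
    (by
      intro v
      simp only [FunLike.coe_add, FunLike.coe_sub, Pi.add_apply, Pi.sub_apply,
        ContinuousLinearMap.id_apply, ContinuousLinearMap.smulRight_apply, FunLike.coe_smul,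
        Pi.smul_apply, map_add, map_smul, smul_eq_mul]
      match_scalars <;> (field_simp <;> try ring))
    (by
      intro w
      simp only [FunLike.coe_add, FunLike.coe_sub, Pi.add_apply, Pi.sub_apply,
        ContinuousLinearMap.id_apply, ContinuousLinearMap.smulRight_apply, FunLike.coe_smul,
        Pi.smul_apply, map_sub, map_smul, smul_eq_mul]
      match_scalars <;> (field_simp <;> try ring))

/-- The time-shift equivalence acts as `v ↦ v + φ(v) e₀`. -/
theorem timeShiftEquiv_apply (φ : E4 →L[ℝ] ℝ) (h : 1 + φ (E4.basisVector 0) ≠ 0) (v : E4) :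
    timeShiftEquiv φ h v = v + φ v • E4.basisVector 0 := rfl

/-- As a continuous linear map the time-shift equivalence is `id + φ ⊗ e₀`. -/
theorem coe_timeShiftEquiv (φ : E4 →L[ℝ] ℝ) (h : 1 + φ (E4.basisVector 0) ≠ 0) :
    (timeShiftEquiv φ h : E4 →L[ℝ] E4) = ContinuousLinearMap.id ℝ E4 + φ.smulRight (E4.basisVector 0) := rfl

/-- **A time-shift map with `1 + ∂₀g ≠ 0` maps neighbourhoods onto neighbourhoods** (inverse function
theorem): if `g` has strict derivative `φ` at `x` with `1 + φ(e₀) ≠ 0`, then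
`map (x ↦ x + g x • e₀) (𝓝 x) = 𝓝 (x + g x • e₀)`. -/
theorem map_nhds_timeShift {g : E4 → ℝ} {φ : E4 →L[ℝ] ℝ} {x : E4} (hg : HasStrictFDerivAt g φ x)
    (h : 1 + φ (E4.basisVector 0) ≠ 0) :
    map (fun y ↦ y + g y • E4.basisVector 0) (𝓝 x) = 𝓝 (x + g x • E4.basisVector 0) := by
  have hΦ : HasStrictFDerivAt (fun y ↦ y + g y • E4.basisVector 0)
      ((timeShiftEquiv φ h : E4 ≃L[ℝ] E4) : E4 →L[ℝ] E4) x := by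
    rw [coe_timeShiftEquiv]
    exact (hasStrictFDerivAt_id x).add (hg.smul_const (E4.basisVector 0))
  exact hΦ.map_nhds_eq_of_equiv

end TimeShift

/-! ## Open embeddings from coordinates -/

section Coords

/-- **Open embedding of a chart given in coordinates.** Let `U, V` be open subsets of `E4`,
`f : U → V` a map given in coordinates by `Φ : E4 → E4` (`(f y).1 = Φ y.1`), and `W ⊆ U` open (in `U`).
If `Φ` is continuous at and neighbourhood-surjective at every point of `W` (`map Φ (𝓝 y) = 𝓝 (Φ y)`) and
injective on `W`, then `f|_W` is an open embedding. -/
theorem isOpenEmbedding_restrict_of_coords {U V : TopologicalSpace.Opens E4} (f : U → V) (Φ : E4 → E4)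
    (hf : ∀ y : U, ((f y : V) : E4) = Φ y.1) {W : Set U} (hW : IsOpen W)
    (hnhds : ∀ y ∈ W, map Φ (𝓝 (y : E4)) = 𝓝 (Φ y)) (hinj : InjOn (fun y : U ↦ Φ y.1) W) :
    Topology.IsOpenEmbedding (W.restrict f) := by
  have hcomp : (Subtype.val ∘ W.restrict f) = Φ ∘ fun y : W ↦ (y.1.1 : E4) := funext fun y ↦ hf y.1
  have hι : Topology.IsOpenEmbedding (fun y : W ↦ (y.1.1 : E4)) :=
    U.isOpen.isOpenEmbedding_subtypeVal.comp hW.isOpenEmbedding_subtypeVal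
  refine Topology.IsOpenEmbedding.of_continuous_injective_isOpenMap ?_ ?_ ?_
  · -- continuity: `val ∘ (W.restrict f) = Φ ∘ val ∘ val` is continuous
    refine continuous_induced_rng.2 ?_
    rw [hcomp]
    refine continuous_iff_continuousAt.2 fun y ↦ ContinuousAt.comp (g := Φ) ?_ hι.continuous.continuousAt
    exact (hnhds y.1 y.2).le
  · intro a b hab
    apply Subtype.ext
    apply hinj a.2 b.2
    have := congrArg (fun v : V ↦ (v : E4)) hab
    simpa [Set.restrict_apply, hf] using this
  · rw [isOpenMap_iff_nhds_le]
    intro y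
    have h1 : map (fun z : W ↦ (z.1.1 : E4)) (𝓝 y) = 𝓝 (y.1.1 : E4) := hι.map_nhds_eq y
    have h2 : map (Subtype.val ∘ W.restrict f) (𝓝 y) = 𝓝 ((W.restrict f y : V) : E4) := by
      rw [hcomp, ← Filter.map_map, h1, hnhds y.1 y.2]
      congr 1
      exact (hf y.1).symm
    have h3 : map Subtype.val (𝓝 (W.restrict f y)) = 𝓝 ((W.restrict f y : V) : E4) :=
      V.isOpen.isOpenEmbedding_subtypeVal.map_nhds_eq _
    have h4 : map Subtype.val (map (W.restrict f) (𝓝 y)) = map Subtype.val (𝓝 (W.restrict f y)) := by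
      rw [Filter.map_map, h2, h3]
    exact (Filter.map_injective Subtype.val_injective h4).ge

end Coords

/-! ## Smoothness of the concrete maps -/

section Smooth

variable {M : ℝ}

/-- The derivative of `‖·‖ ∘ spatial` at a point off the time axis. -/
theorem hasFDerivAt_spatialNorm {x : E4} (hx : E4.spatialNorm x ≠ 0) :
    HasFDerivAt E4.spatialNorm
      ((E4.spatialNorm x)⁻¹ • ((innerSL ℝ (E4.spatial x)).comp E4.spatial)) x := by
  have h0 : E4.spatial x ≠ 0 := fun h ↦ hx (by simp [E4.spatialNorm, h])
  -- derivative of the norm on `E3` at a nonzero point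
  have h1 : HasFDerivAt (fun z : E3 ↦ ‖z‖) ((‖E4.spatial x‖)⁻¹ • innerSL ℝ (E4.spatial x)) (E4.spatial x) := by
    have hsq := (hasStrictFDerivAt_norm_sq (E4.spatial x)).hasFDerivAt
    have hpos : 0 < ‖E4.spatial x‖ ^ 2 := by positivity
    have h2 := hsq.sqrt hpos.ne'
    have h3 : (fun z : E3 ↦ Real.sqrt (‖z‖ ^ 2)) = fun z ↦ ‖z‖ := by
      funext z; exact Real.sqrt_sq (norm_nonneg z)
    rw [h3] at h2
    refine h2.congr_fderiv ?_
    rw [Real.sqrt_sq (norm_nonneg _)]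
    ext v
    simp only [FunLike.coe_smul, Pi.smul_apply, two_smul, FunLike.coe_add,
      Pi.add_apply, smul_eq_mul]
    field_simp
    ring
  exact h1.comp x E4.spatial.hasFDerivAt

/-- The spatial radius is smooth off the time axis. -/
theorem contDiffAt_spatialNorm {x : E4} (hx : E4.spatialNorm x ≠ 0) {n : WithTop ℕ∞} :
    ContDiffAt ℝ n E4.spatialNorm x := by
  have h0 : E4.spatial x ≠ 0 := fun h ↦ hx (by simp [E4.spatialNorm, h])
  exact (contDiffAt_norm ℝ h0).comp x E4.spatial.contDiff.contDiffAt

/-- The coordinate `x⁰` is smooth. -/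
theorem contDiff_apply_zero {n : WithTop ℕ∞} : ContDiff ℝ n fun x : E4 ↦ x 0 :=
  (EuclideanSpace.proj (0 : Fin 4) (𝕜 := ℝ)).contDiff

/-- The time squash is smooth. -/
theorem contDiff_timeSquash (τ₀ : ℝ) {n : ℕ∞} : ContDiff ℝ n (timeSquash τ₀) := by
  unfold timeSquash
  exact contDiff_const.add (((contDiff_id.sub contDiff_const).sub contDiff_const).mul
    (Real.smoothTransition.contDiff.comp (contDiff_id.sub contDiff_const)))

/-- The time squash lands above `τ₀`. -/
theorem lt_timeSquash (τ₀ t : ℝ) : τ₀ < timeSquash τ₀ t := by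
  unfold timeSquash
  have h0 := Real.smoothTransition.nonneg (t - τ₀)
  have h1 := Real.smoothTransition.le_one (t - τ₀)
  by_cases ht : τ₀ + 1 ≤ t
  · nlinarith
  · by_cases ht' : t ≤ τ₀
    · rw [Real.smoothTransition.zero_of_nonpos (by linarith)]; linarith
    · have h2 : (t - τ₀ - 1) * 1 ≤ (t - τ₀ - 1) * Real.smoothTransition (t - τ₀) :=
        mul_le_mul_of_nonpos_left h1 (by linarith)
      linarith

/-- The time squash is the identity on `[τ₀ + 1, ∞)`. -/
theorem timeSquash_of_le {τ₀ t : ℝ} (ht : τ₀ + 1 ≤ t) : timeSquash τ₀ t = t := by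
  unfold timeSquash
  rw [Real.smoothTransition.one_of_one_le (by linarith)]; ring

/-- The squash map is smooth. -/
theorem contDiff_squashMap (τ₀ : ℝ) {n : ℕ∞} : ContDiff ℝ n (squashMap τ₀) := by
  unfold squashMap
  exact contDiff_id.add ((((contDiff_timeSquash τ₀).comp contDiff_apply_zero).sub contDiff_apply_zero).smul
    contDiff_const)

/-- The squash map lands in the half-space `{x⁰ > τ₀}`. -/
theorem lt_squashMap_apply_zero (τ₀ : ℝ) (x : E4) : τ₀ < squashMap τ₀ x 0 := by
  rw [squashMap_eq]; simp [lt_timeSquash]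

/-- The squash map is the identity on `{x⁰ ≥ τ₀ + 1}`. -/
theorem squashMap_of_le {τ₀ : ℝ} {x : E4} (hx : τ₀ + 1 ≤ x 0) : squashMap τ₀ x = x := by
  rw [squashMap_eq, timeSquash_of_le hx, sub_self, zero_smul, add_zero]

/-- The squash map preserves the spatial radius. -/
theorem spatialNorm_squashMap (τ₀ : ℝ) (x : E4) : E4.spatialNorm (squashMap τ₀ x) = E4.spatialNorm x := by
  rw [squashMap_eq, spatialNorm_add_smul_basisVector]

/-- The bending is jointly smooth in `(t, r)` for `r > 2M`. -/
theorem contDiffAt_bend₂ (hM : 0 < M) {p : ℝ × ℝ} (hp : 2 * M < p.2) {n : ℕ∞} :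
    ContDiffAt ℝ n (fun q : ℝ × ℝ ↦ bend M q.1 q.2) p := by
  unfold bend
  have h1 : ContDiffAt ℝ n (fun q : ℝ × ℝ ↦ torH M q.2) p := (contDiffAt_torH hM hp).comp p contDiffAt_snd
  have h2 : ContDiffAt ℝ n (fun q : ℝ × ℝ ↦ q.2 / exactRadius M q.1 - 1) p :=
    (contDiffAt_snd.div ((contDiff_exactRadius M).contDiffAt.comp p contDiffAt_fst)
      (exactRadius_pos hM _).ne').sub contDiffAt_const
  exact h1.mul (Real.smoothTransition.contDiffAt.comp p h2)

/-- The scalar `x ↦ bend M x⁰ ‖x̃‖` is smooth where `‖x̃‖ > 2M`. -/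
theorem contDiffAt_bendAt (hM : 0 < M) {x : E4} (hx : 2 * M < E4.spatialNorm x) {n : ℕ∞} :
    ContDiffAt ℝ n (fun y : E4 ↦ bend M (y 0) (E4.spatialNorm y)) x := by
  have hx0 : E4.spatialNorm x ≠ 0 := by linarith
  have hpair : ContDiffAt ℝ n (fun y : E4 ↦ (y 0, E4.spatialNorm y)) x :=
    contDiff_apply_zero.contDiffAt.prodMk (contDiffAt_spatialNorm hx0)
  exact (contDiffAt_bend₂ hM (p := (x 0, E4.spatialNorm x)) hx).comp x hpair

/-- The bent map is smooth where `‖x̃‖ > 2M`. -/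
theorem contDiffAt_bentMap (hM : 0 < M) {x : E4} (hx : 2 * M < E4.spatialNorm x) {n : ℕ∞} :
    ContDiffAt ℝ n (bentMap M) x := by
  have : bentMap M = fun y ↦ y + bend M (y 0) (E4.spatialNorm y) • E4.basisVector 0 := rfl
  rw [this]
  exact contDiffAt_id.add ((contDiffAt_bendAt hM hx).smul contDiffAt_const)

/-- The hole map is smooth where `‖x̃‖ > 2M`. -/
theorem contDiffAt_holeMap (hM : 0 < M) (τ₀ : ℝ) {x : E4} (hx : 2 * M < E4.spatialNorm x) {n : ℕ∞} :
    ContDiffAt ℝ n (holeMap M τ₀) x := by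
  have : holeMap M τ₀ = bentMap M ∘ squashMap τ₀ := rfl
  rw [this]
  refine ContDiffAt.comp x ?_ (contDiff_squashMap τ₀).contDiffAt
  exact contDiffAt_bentMap hM (by rwa [spatialNorm_squashMap])

/-- The flat map is smooth where `‖x̃‖ > 2M`. -/
theorem contDiffAt_outMap (hM : 0 < M) {x : E4} (hx : 2 * M < E4.spatialNorm x) {n : ℕ∞} :
    ContDiffAt ℝ n (outMap M) x := by
  have : outMap M = fun y ↦ y + (2 * torH M (E4.spatialNorm y)) • E4.basisVector 0 := rfl
  rw [this]
  have hx0 : E4.spatialNorm x ≠ 0 := by linarith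
  exact contDiffAt_id.add ((contDiffAt_const.mul ((contDiffAt_torH hM hx).comp x
    (contDiffAt_spatialNorm hx0))).smul contDiffAt_const)

/-- The bent map preserves the spatial radius. -/
theorem spatialNorm_bentMap (M : ℝ) (x : E4) : E4.spatialNorm (bentMap M x) = E4.spatialNorm x := by
  rw [bentMap_eq, spatialNorm_add_smul_basisVector]

/-- The bent map preserves the spatial part. -/
theorem spatial_bentMap (M : ℝ) (x : E4) : E4.spatial (bentMap M x) = E4.spatial x := by
  rw [bentMap_eq, spatial_add_smul_basisVector]

/-- The time coordinate of the bent map. -/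
theorem bentMap_apply_zero (M : ℝ) (x : E4) : bentMap M x 0 = x 0 + bend M (x 0) (E4.spatialNorm x) := by
  rw [bentMap_eq]; simp

/-- The hole map preserves the spatial radius. -/
theorem spatialNorm_holeMap (M τ₀ : ℝ) (x : E4) : E4.spatialNorm (holeMap M τ₀ x) = E4.spatialNorm x := by
  rw [holeMap_eq, spatialNorm_bentMap, spatialNorm_squashMap]

/-- The hole map is the bent map on `{x⁰ ≥ τ₀ + 1}`. -/
theorem holeMap_of_le {τ₀ : ℝ} (M : ℝ) {x : E4} (hx : τ₀ + 1 ≤ x 0) : holeMap M τ₀ x = bentMap M x := by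
  rw [holeMap_eq, squashMap_of_le hx]

/-- The flat map preserves the spatial radius. -/
theorem spatialNorm_outMap (M : ℝ) (x : E4) : E4.spatialNorm (outMap M x) = E4.spatialNorm x := by
  rw [outMap_eq, spatialNorm_add_smul_basisVector]

/-- The flat map preserves the spatial part. -/
theorem spatial_outMap (M : ℝ) (x : E4) : E4.spatial (outMap M x) = E4.spatial x := by
  rw [outMap_eq, spatial_add_smul_basisVector]

/-- The time coordinate of the flat map. -/
theorem outMap_apply_zero (M : ℝ) (x : E4) : outMap M x 0 = x 0 + 2 * torH M (E4.spatialNorm x) := by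
  rw [outMap_eq]; simp

/-- Static time of the flat image: `t(outMap x) = x⁰ + torH(‖x̃‖)`. -/
theorem staticTime_outMap (M : ℝ) (x : E4) : staticTime M (outMap M x) = x 0 + torH M (E4.spatialNorm x) := by
  rw [staticTime_eq, outMap_apply_zero, spatialNorm_outMap]; ring

/-- Static time of the bent image: `t(bentMap x) = x⁰ + bend − torH(‖x̃‖)`. -/
theorem staticTime_bentMap (M : ℝ) (x : E4) :
    staticTime M (bentMap M x) = x 0 + bend M (x 0) (E4.spatialNorm x) - torH M (E4.spatialNorm x) := by
  rw [staticTime_eq, bentMap_apply_zero, spatialNorm_bentMap]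

end Smooth

/-! ## The `e₀`-component of the differentials -/

section Normal

variable {M : ℝ}

/-- The `e₀`-derivative of a function of the spatial radius vanishes. -/
theorem fderiv_comp_spatialNorm_basisVector {f : ℝ → ℝ} {x : E4} (hx : E4.spatialNorm x ≠ 0)
    (hf : DifferentiableAt ℝ f (E4.spatialNorm x)) :
    fderiv ℝ (fun y : E4 ↦ f (E4.spatialNorm y)) x (E4.basisVector 0) = 0 := by
  have hd : DifferentiableAt ℝ (fun y : E4 ↦ f (E4.spatialNorm y)) x :=
    hf.comp x ((contDiffAt_spatialNorm hx (n := 1)).differentiableAt (by norm_num))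
  have hline : HasDerivAt (fun s : ℝ ↦ x + s • E4.basisVector 0) (E4.basisVector 0) 0 := by
    simpa using ((hasDerivAt_id (0 : ℝ)).smul_const (E4.basisVector 0)).const_add x
  have h1 : HasDerivAt ((fun y : E4 ↦ f (E4.spatialNorm y)) ∘ fun s : ℝ ↦ x + s • E4.basisVector 0)
      (fderiv ℝ (fun y : E4 ↦ f (E4.spatialNorm y)) x (E4.basisVector 0)) 0 :=
    hd.hasFDerivAt.comp_hasDerivAt_of_eq (0 : ℝ) hline (by simp)
  have h2 : ((fun y : E4 ↦ f (E4.spatialNorm y)) ∘ fun s : ℝ ↦ x + s • E4.basisVector 0) =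
      fun _ ↦ f (E4.spatialNorm x) := by
    funext s
    simp only [Function.comp_apply, spatialNorm_add_smul_basisVector]
  rw [h2] at h1
  exact h1.unique (hasDerivAt_const 0 _)

end Normal

/-- **Anchor of part 6** (registered sub-goal of `stub_regionOneDecomposition`): the hole map is smooth off
the horizon and preserves the areal radius. -/
theorem regionOneHoleChart_anchor : ∀ (M τ₀ : ℝ), 0 < M → ∀ x : E4, 2 * M < E4.spatialNorm x → ContDiffAt ℝ 2 (holeMap M τ₀) x ∧ E4.spatialNorm (holeMap M τ₀ x) = E4.spatialNorm x := by
  intro M τ₀ hM x hx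
  exact ⟨contDiffAt_holeMap hM τ₀ hx, spatialNorm_holeMap M τ₀ x⟩

end Summit.FinalStateConjecture.FinalStateConjecture.Theorems.SwallowTheDatum.UniversalWitnessFamily

end
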